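import Summits.HodgeConjecture.HodgeConjecture.Theorems.Ring2TransportCommutantBaseChange
import Summits.HodgeConjecture.HodgeConjecture.Theorems.Ring2TransportCommutantEtale
import HarnessLib

/-!
# Ring 2 transport — Deligne's CM criterion, abstract form (linear algebra for node 44, converse half; part 3 of 4)

research route conditional on HC_CM; not a corollary; Q11.4-sentence-2 already refuted in dim ≥ 3.

Cell `pub-hodge-ring2`, seat `transport`, gen 51; helper file (pure algebra, no Hodge theory, no open hypothesis).
`Commutant.exists_subalgebra_comm_reduced_of_commutant`: let a semisimple `F`-algebra `R₀` act faithfully on a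
finite-dimensional `F`-space `V` (`ρ : R₀ →ₐ[F] (End_F V)ᵐᵒᵖ` injective — as `End⁰(A)` acts on `H¹` by pull-back), and
let `G ⊆ End_K(K ⊗_F V)` be a set of pairwise commuting endomorphisms commuting with `R₀` whose commutant is
`K`-spanned by `R₀` ("`E ⊗ K` is the commutant of `G`"). Then `R₀` contains a commutative reduced `F`-subalgebra of
dimension `dim_F V`. With `E` the image of `R₀` and `Z := C(E)`: base change of commutants and descent (part 1) give
`Z ⊆ E` and `C(Z) ⊆ E`; `Z` is commutative, and reduced because `R₀` is semisimple (central nilpotents vanish); part 2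
applied to `Z` acting on `V` gives the subalgebra inside `C(Z) ⊆ E`, pulled back along `ρ`. This is the linear
algebra of Deligne, LNM 900 I §5, proof of Prop. 5.1, direction `⇒` (printed sentences, verbatim: "Therefore E is the
commutant of G in End(H₁(A,ℚ))" and "The commutant of G therefore contains étale commutative algebras of rank
dim H₁(A,ℚ) over ℚ"; the bicommutant formulation `Z ⊆ E`, `C(Z) ⊆ E` above is OUR paraphrase of that step). Used by
`Ring2TransportCMTypeOfCommutativeMumfordTate` (part 4). References: Deligne, LNM 900 (1982) I §5 Prop. 5.1.
-/

set_option linter.dupNamespace false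

noncomputable section

namespace Summit.HodgeConjecture.HodgeConjecture.Ring2Transport

namespace Commutant

open scoped TensorProduct

/-! ## §5 Assembly of the algebra: from the commutant hypotheses to a CM subalgebra -/

section Assembly

variable {F K : Type*} [Field F] [Field K] [Algebra F K]
  {V : Type*} [AddCommGroup V] [Module F V] [FiniteDimensional F V]
  {R₀ : Type*} [Ring R₀] [Algebra F R₀] [IsSemisimpleRing R₀]

/-- **Deligne's criterion, abstract form** (LNM 900 I §5, proof of Prop. 5.1, direction `⇒`, as linear
algebra). Let a semisimple `F`-algebra `R₀` act faithfully on a finite-dimensional `V` (through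
`ρ : R₀ → (End_F V)ᵐᵒᵖ`, as `End⁰(A)` acts on `H¹` by pull-back), and let `G` be a set of pairwise
commuting `K`-linear automorphisms of `K ⊗_F V` commuting with `R₀` such that the commutant of `G` is
spanned over `K` by `R₀` (hypothesis `hR`: "`E ⊗ K` is the commutant of `G`"). Then `R₀` contains a
commutative reduced `F`-subalgebra of dimension `dim_F V` — i.e. the CM condition. Proof: with `E` the image
of `R₀` and `Z` its commutant in `End_F V`, base change of commutants and descent give `Z ⊆ E ⊇ Z'`, so `Z` is
the centre of `E`, reduced as `R₀` is semisimple, `E = End_Z(V)`, and `exists_subalgebra_comm_reduced_finrank_eq`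
applies. [cite: Deligne1982HodgeCycles, I §5 Prop. 5.1 (proof)] -/
theorem exists_subalgebra_comm_reduced_of_commutant
    (ρ : R₀ →ₐ[F] (Module.End F V)ᵐᵒᵖ) (hρ : Function.Injective ρ)
    (G : Set (Module.End K (K ⊗[F] V)))
    (hG : ∀ u ∈ G, ∀ u' ∈ G, u * u' = u' * u)
    (hT1 : ∀ (r : R₀), ∀ u ∈ G, u * (MulOpposite.unop (ρ r)).baseChange K =
      (MulOpposite.unop (ρ r)).baseChange K * u)
    (hR : ∀ x : Module.End K (K ⊗[F] V), (∀ u ∈ G, x * u = u * x) →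
      x ∈ Submodule.span K (Set.range fun r : R₀ => (MulOpposite.unop (ρ r)).baseChange K)) :
    ∃ S : Subalgebra F R₀, IsReduced S ∧ (∀ a ∈ S, ∀ b ∈ S, a * b = b * a) ∧
      Module.finrank F S = Module.finrank F V := by
  classical
  -- `E` = the image of `R₀` in `End_F V`, `Z` = its commutant
  let E : Subalgebra F (Module.End F V) := ρ.range.unop
  have hE : ∀ x, x ∈ E ↔ ∃ r, MulOpposite.unop (ρ r) = x := by
    intro x
    rw [Subalgebra.mem_unop, AlgHom.mem_range]
    constructor
    · rintro ⟨r, hr⟩; exact ⟨r, by rw [hr, MulOpposite.unop_op]⟩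
    · rintro ⟨r, hr⟩; exact ⟨r, by rw [← hr, MulOpposite.op_unop]⟩
  let Z : Subalgebra F (Module.End F V) := Subalgebra.centralizer F (E : Set (Module.End F V))
  have hEK : (fun s : Module.End F V => s.baseChange K) '' (E : Set (Module.End F V)) =
      Set.range fun r : R₀ => (MulOpposite.unop (ρ r)).baseChange K := by
    ext y
    constructor
    · rintro ⟨x, hx, rfl⟩
      obtain ⟨r, rfl⟩ := (hE x).1 hx
      exact ⟨r, rfl⟩
    · rintro ⟨r, rfl⟩
      exact ⟨_, (hE _).2 ⟨r, rfl⟩, rfl⟩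
  set EK := Submodule.span K (Set.range fun r : R₀ => (MulOpposite.unop (ρ r)).baseChange K)
    with hEKdef
  -- commuting with a set of endomorphisms means commuting with its `K`-span
  have hspan : ∀ (T : Set (Module.End K (K ⊗[F] V))) (x : Module.End K (K ⊗[F] V)),
      (∀ t ∈ T, x * t = t * x) → ∀ y ∈ Submodule.span K T, x * y = y * x := by
    intro T x hx y hy
    have hle : Submodule.span K T ≤ Subalgebra.toSubmodule (Subalgebra.centralizer K {x}) :=
      Submodule.span_le.2 fun t ht => by
        rw [SetLike.mem_coe, Subalgebra.mem_toSubmodule, Subalgebra.mem_centralizer_iff]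
        intro g hg
        rw [Set.mem_singleton_iff.1 hg]
        exact hx t ht
    have := hle hy
    rw [Subalgebra.mem_toSubmodule, Subalgebra.mem_centralizer_iff] at this
    exact this x (Set.mem_singleton x)
  -- the commutant of `G` is `E_K`
  have hCK : ∀ x : Module.End K (K ⊗[F] V), (∀ u ∈ G, x * u = u * x) ↔ x ∈ EK := by
    intro x
    constructor
    · exact hR x
    · intro hx u hu
      exact (hspan _ u (by rintro _ ⟨r, rfl⟩; exact hT1 r u hu) x hx).symm
  -- (b) `Z ⊆ E`
  have hZE : Z ≤ E := by
    intro z hz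
    rw [Subalgebra.mem_centralizer_iff] at hz
    have h1 : ∀ y ∈ EK, z.baseChange K * y = y * z.baseChange K := by
      refine hspan _ _ ?_
      rintro _ ⟨r, rfl⟩
      rw [← LinearMap.baseChange_mul, ← LinearMap.baseChange_mul]
      congr 1
      exact (hz _ ((hE _).2 ⟨r, rfl⟩)).symm
    have h2 : ∀ u ∈ G, z.baseChange K * u = u * z.baseChange K :=
      fun u hu => h1 u ((hCK u).1 fun u' hu' => hG u hu u' hu')
    have h3 : z.baseChange K ∈ EK := hR _ h2
    refine mem_of_baseChange_mem_span (K := K) (Subalgebra.toSubmodule E) z ?_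
    rwa [Subalgebra.coe_toSubmodule, hEK]
  -- (c) `Z' ⊆ E`
  have hCZE : ∀ y : Module.End F V, (∀ z ∈ Z, y * z = z * y) → y ∈ E := by
    intro y hy
    have hGZ : ∀ u ∈ G, u ∈ Submodule.span K ((fun s : Module.End F V => s.baseChange K) ''
        {s | ∀ t ∈ (E : Set (Module.End F V)), s * t = t * s}) := by
      intro u hu
      refine mem_span_baseChange_centralizer (E : Set (Module.End F V)) u fun t ht => ?_
      obtain ⟨r, rfl⟩ := (hE t).1 ht
      exact hT1 r u hu
    have hy' : ∀ u ∈ G, y.baseChange K * u = u * y.baseChange K := by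
      intro u hu
      refine hspan _ _ ?_ u (hGZ u hu)
      rintro _ ⟨s, hs, rfl⟩
      rw [← LinearMap.baseChange_mul, ← LinearMap.baseChange_mul]
      congr 1
      refine hy s ?_
      rw [Subalgebra.mem_centralizer_iff]
      exact fun g hg => (hs g hg).symm
    have h3 : y.baseChange K ∈ EK := hR _ hy'
    refine mem_of_baseChange_mem_span (K := K) (Subalgebra.toSubmodule E) y ?_
    rwa [Subalgebra.coe_toSubmodule, hEK]
  -- (a) `Z` is commutative, (d) and reduced (`R₀` is semisimple)
  have hZcomm : ∀ z ∈ Z, ∀ z' ∈ Z, z * z' = z' * z := by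
    intro z hz z' hz'
    rw [Subalgebra.mem_centralizer_iff] at hz
    exact (hz z' (hZE hz')).symm
  have hZred : ∀ z ∈ Z, IsNilpotent z → z = 0 := by
    intro z hz hn
    obtain ⟨r, hr⟩ := (hE z).1 (hZE hz)
    rw [Subalgebra.mem_centralizer_iff] at hz
    have hrc : ∀ r' : R₀, r * r' = r' * r := by
      intro r'
      apply hρ
      rw [map_mul, map_mul, ← MulOpposite.op_unop (ρ r), ← MulOpposite.op_unop (ρ r'), hr,
        ← MulOpposite.op_mul, ← MulOpposite.op_mul]
      congr 1
      exact hz _ ((hE _).2 ⟨r', rfl⟩)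
    have hrn : IsNilpotent r := by
      obtain ⟨n, hn⟩ := hn
      refine ⟨n, hρ ?_⟩
      rw [map_pow, map_zero, ← MulOpposite.op_unop (ρ r), hr, ← MulOpposite.op_pow, hn,
        MulOpposite.op_zero]
    have := eq_zero_of_isNilpotent_of_forall_commute hrc hrn
    rw [← hr, this, map_zero, MulOpposite.unop_zero]
  -- (e) the étale subalgebra of `End_Z(V) = E`
  letI : CommRing Z :=
    { (inferInstance : Ring Z) with mul_comm := fun a b => Subtype.ext (hZcomm a a.2 b b.2) }
  haveI : IsReduced Z := ⟨fun a ⟨n, hn⟩ => Subtype.ext (by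
    rw [ZeroMemClass.coe_zero]
    refine hZred a a.2 ⟨n, ?_⟩
    have := congrArg Subtype.val hn
    rwa [SubmonoidClass.coe_pow, ZeroMemClass.coe_zero] at this)⟩
  haveI : Module.Finite F Z :=
    Module.Finite.of_injective (Subalgebra.toSubmodule Z).subtype Subtype.val_injective
  -- `Z` acts on `V` through `End_F V` (Mathlib's subalgebra action), compatibly with `F`
  haveI : IsScalarTower F Z V := ⟨fun c z v => by
    change ((c • z : Z) : Module.End F V) v = c • (z : Module.End F V) v
    rw [Subalgebra.coe_smul, LinearMap.smul_apply]⟩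
  obtain ⟨B, hBZ, hBcomm, hBred, hBdim⟩ :=
    exists_subalgebra_comm_reduced_finrank_eq (F := F) (Z := Z) (V := V)
  have hBE : B ≤ E := fun x hx =>
    hCZE x fun z hz => LinearMap.ext fun v => hBZ x hx ⟨z, hz⟩ v
  -- (f) pull back along `ρ`
  let S : Subalgebra F R₀ := (B.op).comap ρ
  have hS : ∀ a, a ∈ S ↔ MulOpposite.unop (ρ a) ∈ B := fun a => by
    rw [Subalgebra.mem_comap, Subalgebra.mem_op]
  refine ⟨S, ?_, ?_, ?_⟩
  · constructor
    rintro ⟨a, ha⟩ ⟨n, hn⟩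
    have hn' : a ^ n = 0 := by
      have := congrArg Subtype.val hn
      rwa [SubmonoidClass.coe_pow, ZeroMemClass.coe_zero] at this
    have hb : (⟨MulOpposite.unop (ρ a), (hS a).1 ha⟩ : B) = 0 := by
      apply hBred.eq_zero
      refine ⟨n, Subtype.ext ?_⟩
      rw [SubmonoidClass.coe_pow, ZeroMemClass.coe_zero, ← MulOpposite.unop_pow, ← map_pow, hn', map_zero,
        MulOpposite.unop_zero]
    apply Subtype.ext
    apply hρ
    rw [ZeroMemClass.coe_zero, map_zero, ← MulOpposite.op_unop (ρ a),
      show MulOpposite.unop (ρ a) = 0 from congrArg Subtype.val hb, MulOpposite.op_zero]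
  · intro a ha b hb
    apply hρ
    rw [map_mul, map_mul, ← MulOpposite.op_unop (ρ a), ← MulOpposite.op_unop (ρ b),
      ← MulOpposite.op_mul, ← MulOpposite.op_mul, hBcomm _ ((hS b).1 hb) _ ((hS a).1 ha)]
  · let ψ : S →ₗ[F] B :=
      { toFun := fun a => ⟨MulOpposite.unop (ρ a), (hS a).1 a.2⟩
        map_add' := fun a b => Subtype.ext (by
          simp only [Subalgebra.coe_add, map_add, MulOpposite.unop_add, AddMemClass.mk_add_mk])
        map_smul' := fun c a => Subtype.ext (by
          simp only [Subalgebra.coe_smul, map_smul, MulOpposite.unop_smul, RingHom.id_apply,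
            SetLike.mk_smul_mk]) }
    have hψ : Function.Bijective ψ := by
      constructor
      · intro a b h
        apply Subtype.ext
        apply hρ
        exact MulOpposite.unop_injective (congrArg Subtype.val h)
      · rintro ⟨x, hx⟩
        obtain ⟨r, hr⟩ := (hE x).1 (hBE hx)
        exact ⟨⟨r, (hS r).2 (by rw [hr]; exact hx)⟩, Subtype.ext hr⟩
    rw [← hBdim]
    exact (LinearEquiv.ofBijective ψ hψ).finrank_eq

end Assembly

end Commutant

end Summit.HodgeConjecture.HodgeConjecture.Ring2Transport

end
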